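import Summits.QuantumAdvantage.QuantumAdvantage.Theses.KummerSector
import Literature.Computability.Cryptography.VanDamSeroussiGaussSums
import Literature.Computability.QuantumComplexity.CWrapAssembly
import Literature.Computability.Cryptography.QubitRegisterCliffordTProofs
import HarnessLib

/-!
# Line `birth` — BC3 skeleton for the crux `KsMemBQP` (stmt-QuantumAdvantage-1614)

Route `KummerSector` (route-QuantumAdvantage-KummerSector; deciding theorem
`closes (h₁ : KsMemBQP) (h₂ : KsLowerClassesMemBQP) (h₃ : vanDamSeroussi2002) : QuantumAdvantage`),
crux (rank 2)

  `KsMemBQP := encodingNatBool.toLanguage {p | p.Prime ∧ p % 3 = 1 ∧ √p < Σ_{x<p} cos(2πx³/p)} ∈ BQP`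

— Kummer's class-I language `KS` is decided with bounded error by a `P`-uniform oracle-free Clifford+T
family (tree model `Literature.Computability.Cryptography.BQP`).

## The line (the route's own informal plan, cut along the quantum / arithmetic / complexity seams)

Write `G_p := Σ_{x<p} cos(2πx³/p)` and `g := g(χ_{p,r}) = cubicGaussSum p r` for a primitive root `r`
mod `p` (the tree's cubic residue character `Literature.NumberTheory.GaussSums.cubicChar`).

* `stub_search` (QUANTUM, size L–XL; van Dam–Seroussi 2002 §4 Thm 1 + Shor): the SEARCH problem "on input
  `bin p` (`p` prime, `p ≡ 1 (3)`; no requirement on other inputs) output, SELF-DELIMITED as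
  `⟨bin r, ⟨bin m, tail⟩⟩`, a primitive root `r` mod `p` together with a grid point `m < 12` with
  `|arg(g(χ_{p,r}) · e^{−2πi m/12})| ≤ π/6`" is `IsQSolvable`.  Ingredients, all but one in the tree: coins
  (Hadamard ancillas) + Shor's factoring of `p − 1` (`factoring_mem_FBQP_holds`) to CERTIFY a sampled primitive
  root; the van Dam–Seroussi phase estimation for the cubic character (named fact
  `VanDamSeroussi2002_cubicGaussSumPhase_qsolvable`, discharge in progress under
  `Cryptography/VanDamSeroussiCubic*.lean`); classical wraps (`isQSolvable_classicalWrap_holds`).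
  CAVEAT recorded for the stub prover: the named fact's output convention `encodeNat m <+: y` is NOT uniquely
  decodable (`encodeNat` is not prefix-free: `bin 1 <+: bin 3`), so this stub asks for the nested `boolPair`
  form; take it from the discharge's fixed-width read-out, not from the fact's statement; and the joint
  success `2/3` needs the phase block run at finer precision with a median-of-runs vote (valid runs agree to
  within one grid step), since an unverifiable `2/3`-search oracle cannot be amplified answer-wise.
  Why it might fail: only AS TYPED (uniform approximate `F_p` / Kitaev shift block with proved operator-norm
  error — the route's own caveat); mathematically safe.
* `stub_classI` (ARITHMETIC, size M; IrelandRosen1990 §9.12, Prop. 8.3.3): for `p ≡ 1 (3)` prime and any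
  primitive root `r`, `√p < G_p ↔ |arg g(χ_{p,r})| < π/3`.  Proof sketch: `#{x : x³ = y} = 1 + χ(y) + χ̄(y)`, so
  `Σ_x e(x³/p) = g(χ) + g(χ̄) = g + conj g = 2 Re g = 2√p cos(arg g)` (`χ(−1) = 1`, `|g| = √p`:
  `norm_cubicGaussSum`), and `cos θ > 1/2 ↔ |θ| < π/3` on `(−π, π]`.  Independent of the choice of `r`
  (`χ ↔ χ̄` flips the sign of `arg g`).
* `stub_decode` (ALGORITHMIC NUMBER THEORY in `FP`, size L; IrelandRosen1990 §9.4 Lemma 1 + Cor. (`g³ = pπ`,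
  tree: `cubicGaussSum_pow_three`, `jacobiSum_cubicMulChar_primary`), Euclid in `ℤ[ω]`, AKS (tree:
  `PRIMES_mem_P_holds`, `primeFn_mem_FP`)): ONE polynomial-time string function `D` which (a) answers `[false]`
  on `⟨x, w⟩` whenever `x` is not the code of a prime `p ≡ 1 (3)` (input validation: `decodeNat`, AKS, `p % 3`),
  and (b) on `⟨bin p, ⟨bin r, ⟨bin m, z⟩⟩⟩` with `r` a primitive root and `m` a valid grid point returns EXACTLY the
  sector bit `[ |arg g(χ_{p,r})| < π/3 ]`: compute `u := r^{(p−1)/3} mod p`, `π :=` the primary generator of the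
  ideal `(p, u − ω)` of `ℤ[ω]` (Euclidean algorithm for the norm `a² − ab + b²`; then `χ_{p,r} = χ_π` and
  `J(χ,χ) = π`, IR §9.4 Lemma 1, so `arg g ∈ arg(π)/3 + (2π/3)ℤ`), and accept iff the circular distance from
  `2πm/12` to `arg(π)/3` is `< π/3` — with tolerance `π/6` this holds iff the true sector is `0` (the other two
  candidates are `≥ 2π/3 − π/6 = π/2` away); multiplying by `3`, every comparison is `arg π ≷ jπ/2`, i.e. a sign
  test on `(2a − b, b)` for `π = a + bω` — exact integer arithmetic.  Why it might fail: not mathematically; the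
  `FP` bookkeeping of Euclid in `ℤ[ω]` is new to the tree.
* Composition `KsMemBQP_of` (sorry-free, kernel-checked): Bernstein–Vazirani §8 "P-computation is free inside
  BQP" — wrap the search family with the decoder (`isQSolvable_classicalWrap_holds`, pre-processor `id`), observe
  that on EVERY input the wrapped family writes the indicator bit of `KS` first (on the promise by `stub_decode`
  (b) + `stub_classI`; off the promise by (a), where `KS`-membership is false), and read wire `0`
  (`mem_BQP_of_isQSolvable_bit` with the discharged facts `QCircuit.outputPMF_apply_holds`,
  `cliffordT_isUnitary_holds`).  The generic half is `toLanguage_mem_BQP_of_search_decode`.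

`KsLowerClassesMemBQP` (the route's rank-9 companion) falls to the same three stubs with the acceptance window
of `stub_decode` (b) changed (sector `k` and the sign of `arg π`), as the route file says.

Disproof used: none exists for this crux (`ledger crux ls stmt-QuantumAdvantage-1614`: no workfiles, no
`Disproof.lean`, no `Theorems/…/Negative` lemmas; `ledger negatives --problem QuantumAdvantage` touches only the
dropped `KsNotFrobenian`).  `sorry` occurs ONLY in the three `stub_*` theorems; `KsMemBQP_of` takes the three stub
statements (the `Goal.stub_*` abbreviations, restated verbatim by the stubs) as hypotheses and concludes the crux
decl BY NAME; the `example` at the end checks that the registered stubs feed it.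
-/

set_option linter.dupNamespace false
set_option linter.unusedVariables false

namespace Summit.QuantumAdvantage.QuantumAdvantage.Cruxes.KsMemBQP.Birth

open _root_.Computability Literature.Computability.Complexity Literature.Computability.Cryptography
open Literature.NumberTheory.GaussSums (cubicGaussSum)
open Summit.QuantumAdvantage.QuantumAdvantage.Theses.KummerSector (KsMemBQP)

/-! ### The three stub statements (named, so that the composition can take them as hypotheses) -/

namespace Goal

/-- Statement of `stub_search`: primitive root + van Dam–Seroussi phase point (precision `π/6`, grid `2πℤ/12`),
self-delimited, as ONE bounded-error quantum search problem on input `bin p`. -/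
abbrev stub_search : Prop :=
  IsQSolvable fun x : List Bool =>
    {y | ∀ p : ℕ, p.Prime → p % 3 = 1 → x = encodeNat p →
      ∃ (r m : ℕ) (z : List Bool), IsPrimitiveRoot (r : ZMod p) (p - 1) ∧ m < 12 ∧
        |Complex.arg (cubicGaussSum p r * Complex.exp (-(2 * Real.pi * Complex.I * (m : ℂ) / 12)))| ≤
          Real.pi / 6 ∧
        y = boolPair (encodeNat r) (boolPair (encodeNat m) z)}

/-- Statement of `stub_classI`: Kummer's class I is sector `0` of the cubic Gauss sum
(`G_p = 2 Re g(χ)`, IrelandRosen1990 §9.12). -/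
abbrev stub_classI : Prop :=
  ∀ p r : ℕ, p.Prime → p % 3 = 1 → IsPrimitiveRoot (r : ZMod p) (p - 1) →
    (Real.sqrt (p : ℝ) < ∑ x ∈ Finset.range p, Real.cos (2 * Real.pi * (x : ℝ) ^ 3 / (p : ℝ)) ↔
      |Complex.arg (cubicGaussSum p r)| < Real.pi / 3)

/-- Statement of `stub_decode`: the exact classical decision wrap, one `FP` function with input validation. -/
abbrev stub_decode : Prop :=
  ∃ D : List Bool → List Bool, D ∈ FP ∧
    (∀ x w : List Bool, (∀ p : ℕ, p.Prime → p % 3 = 1 → x ≠ encodeNat p) → D (boolPair x w) = [false]) ∧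
    (∀ (p r m : ℕ) (z : List Bool), p.Prime → p % 3 = 1 → IsPrimitiveRoot (r : ZMod p) (p - 1) → m < 12 →
      |Complex.arg (cubicGaussSum p r * Complex.exp (-(2 * Real.pi * Complex.I * (m : ℂ) / 12)))| ≤
        Real.pi / 6 →
      D (boolPair (encodeNat p) (boolPair (encodeNat r) (boolPair (encodeNat m) z))) =
        [decide (|Complex.arg (cubicGaussSum p r)| < Real.pi / 3)])

end Goal

/-! ### The stubs (registered; `sorry` lives only here) -/

/-- **stub_search** (quantum; vanDamSeroussi2002 §4 Thm 1 for `χ_{p,r}` + Shor factoring of `p − 1` to certify a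
sampled primitive root + median-of-runs; L–XL). -/
theorem stub_search : IsQSolvable fun x : List Bool => {y | ∀ p : ℕ, p.Prime → p % 3 = 1 → x = encodeNat p → ∃ (r m : ℕ) (z : List Bool), IsPrimitiveRoot (r : ZMod p) (p - 1) ∧ m < 12 ∧ |Complex.arg (cubicGaussSum p r * Complex.exp (-(2 * Real.pi * Complex.I * (m : ℂ) / 12)))| ≤ Real.pi / 6 ∧ y = boolPair (encodeNat r) (boolPair (encodeNat m) z)} := by
  sorry

/-- **stub_classI** (arithmetic; IrelandRosen1990 §9.12: `Σ_x e(x³/p) = g + conj g`; M). -/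
theorem stub_classI : ∀ p r : ℕ, p.Prime → p % 3 = 1 → IsPrimitiveRoot (r : ZMod p) (p - 1) → (Real.sqrt (p : ℝ) < ∑ x ∈ Finset.range p, Real.cos (2 * Real.pi * (x : ℝ) ^ 3 / (p : ℝ)) ↔ |Complex.arg (cubicGaussSum p r)| < Real.pi / 3) := by
  sorry

/-- **stub_decode** (classical exact decision in `FP`; IrelandRosen1990 §9.4 Lemma 1 + Cor., Euclid in `ℤ[ω]`,
AKS; L). -/
theorem stub_decode : ∃ D : List Bool → List Bool, D ∈ FP ∧ (∀ x w : List Bool, (∀ p : ℕ, p.Prime → p % 3 = 1 → x ≠ encodeNat p) → D (boolPair x w) = [false]) ∧ (∀ (p r m : ℕ) (z : List Bool), p.Prime → p % 3 = 1 → IsPrimitiveRoot (r : ZMod p) (p - 1) → m < 12 → |Complex.arg (cubicGaussSum p r * Complex.exp (-(2 * Real.pi * Complex.I * (m : ℂ) / 12)))| ≤ Real.pi / 6 → D (boolPair (encodeNat p) (boolPair (encodeNat r) (boolPair (encodeNat m) z))) = [decide (|Complex.arg (cubicGaussSum p r)| < Real.pi / 3)]) := by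
  sorry

/-! ### The composition (sorry-free) -/

open scoped Classical in
/-- **Decision from promise-free search + exact decoder** (Bernstein–Vazirani 1997 §8 pattern, generic in the
target set): if a search problem `R` is `IsQSolvable` and an `FP` decoder `D` maps EVERY pair ⟨input, valid
output⟩ to the indicator bit of `encodingNatBool.toLanguage S`, that language is in `BQP`. -/
theorem toLanguage_mem_BQP_of_search_decode {S : Set ℕ} {R : List Bool → Set (List Bool)}
    {D : List Bool → List Bool} (hR : IsQSolvable R) (hD : D ∈ FP)
    (hval : ∀ x, ∀ y ∈ R x, D (boolPair x y) = [decide (x ∈ encodingNatBool.toLanguage S)]) :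
    encodingNatBool.toLanguage S ∈ BQP := by
  have hW := isQSolvable_classicalWrap_holds id D (PolyTimeComputable.id _) hD hR
  refine mem_BQP_of_isQSolvable_bit (fun _ _ => QCircuit.outputPMF_apply_holds) cliffordT_isUnitary_holds
    (L := encodingNatBool.toLanguage S) (bit := fun x => decide (x ∈ encodingNatBool.toLanguage S))
    (fun x => decide_eq_true_iff) ?_
  refine hW.mono fun x z hz => ?_
  obtain ⟨y, hy, hyz⟩ := hz
  rw [hval x y hy] at hyz
  exact hyz

open scoped Classical in
/-- **Composition of the birth line** (kernel-checked, no `sorry`): the three stub statements give the crux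
`Theses.KummerSector.KsMemBQP` BY NAME. -/
theorem KsMemBQP_of (h₁ : Goal.stub_search) (h₂ : Goal.stub_classI) (h₃ : Goal.stub_decode) : KsMemBQP := by
  obtain ⟨D, hDFP, hDoff, hDon⟩ := h₃
  unfold KsMemBQP
  refine toLanguage_mem_BQP_of_search_decode h₁ hDFP fun x y hy => ?_
  by_cases hx : ∃ p : ℕ, p.Prime ∧ p % 3 = 1 ∧ x = encodeNat p
  · obtain ⟨p, hp, h3, rfl⟩ := hx
    obtain ⟨r, m, w, hr, hm, harg, rfl⟩ := hy p hp h3 rfl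
    rw [hDon p r m w hp h3 hr hm harg]
    refine congrArg (fun b => [b]) (decide_eq_decide.mpr ?_)
    refine Iff.trans ?_ (Computability.Encoding.mem_toLanguage_iff encodingNatBool _ p).symm
    exact ⟨fun h => ⟨hp, h3, (h₂ p r hp h3 hr).2 h⟩, fun h => (h₂ p r hp h3 hr).1 h.2.2⟩
  · -- off the promise the decoder answers `[false]`, and `x` is not in the language
    rw [hDoff x y fun p hp h3 hxe => hx ⟨p, hp, h3, hxe⟩]
    refine congrArg (fun b => [b]) (decide_eq_false_iff_not.mpr ?_).symm
    rintro ⟨p, hpS, hpx⟩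
    exact hx ⟨p, hpS.1, hpS.2.1, hpx.symm⟩

/-- The registered stubs feed the composition (checks that the inline stub statements are the `Goal.*` ones). -/
example : KsMemBQP := KsMemBQP_of stub_search stub_classI stub_decode

end Summit.QuantumAdvantage.QuantumAdvantage.Cruxes.KsMemBQP.Birth
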